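import Summits.SmoothPoincare4.SmoothPoincare4.Theses.RicciFat
import Literature.Geometry.Riemannian.VolumeSphereTheoremGHDecomposition

/-!
# Line `saturation_reifenberg` for crux `RicciFat.VolumeSphereRecognition`
# (item stmt-SmoothPoincare4-5191) — the VOLUME-DIRECT Reifenberg cut

Route `route-SmoothPoincare4-RicciFat`, crux rank 2; crux-strategist
planner-cstrat-stmt-SmoothPoincare4-5191-s1-0, 2026-08-17. ALTERNATIVE line registered next to the
live skeleton `Lines/birth.lean` (never overwritten); stub A below is BYTE-IDENTICAL with birth's
`stub_coldingVolumeShapeFour`, so one proof closes it for both lines.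

Crux (fixed, never restated): `∃ δ > 0`, every compact connected `C^∞` 4-manifold with a `C^∞`
Riemannian metric `h`, `Ric_h ≥ 3h`, `Vol(M, h) ≥ (1 − δ)·8π²/3` is `C^∞`-diffeomorphic to
`S⁴ ⊂ ℝ⁵` (Cheeger–Colding 1997, Appendix 1, Thm A.1.10 at `n = 4`).

## The idea: the crux's VOLUME hypothesis makes Reifenberg flatness cheap

Cheeger–Colding prove A.1.12 (the sphere stability used by `birth`'s stub B) "by combining
Theorems A.1.1 and A.1.5" (JDG 46 (1997) p. 458): the curvature-free intrinsic Reifenberg theorem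
A.1.1–A.1.3 (p. 457: two `(ε, r)`-Reifenberg-flat smooth `n`-manifolds at Gromov–Hausdorff distance
`< ε(n)` are DIFFEOMORPHIC) and Colding's Theorem A.1.5 = [26] (Ann. of Math. 145 (1997)), whose
part (ii) is VOLUME CONVERGENCE (a Gromov–Hausdorff-almost-Euclidean ball has almost Euclidean
volume) and whose part (i) is its converse (an almost-maximal-volume ball is Reifenberg flat,
(4.6): `d_GH(B_s(p), B_s(0)) < εs` for all `s ≤ r₁`). Stub B of `birth` has only a METRIC
hypothesis (GH-close to `S⁴`, `Ric ≥ −3`), so its proof must run A.1.5(ii) to recover volume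
control below the GH scale before A.1.5(i) and A.1.3 apply. But the CRUX hands us the volume:
under `Ric ≥ 3` and `Vol(M) ≥ (1 − δ)|S⁴|`, Bishop–Gromov monotonicity of
`r ↦ Vol B̄_r(x) / V₁(r)` on `(0, π]` (`V₁(r) = |S³|∫₀ʳ sin³ = 2π²(2/3 − cos r + cos³ r/3)`, the
volume of the `r`-ball of the unit `S⁴`; `B̄_π(x) = M` by Myers) gives
`Vol B̄_r(x) ≥ (1 − δ) V₁(r)` for EVERY centre and EVERY radius `r ≤ π` ("saturation", stub S) —
so every ball at every scale is almost maximal, A.1.5(i) makes `(M, d_h)` uniformly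
`(ε, r₀)`-Reifenberg flat (stub R), and A.1.3 against the round `S⁴` (stub T), fed the global
Gromov–Hausdorff closeness of Colding's Shape theorem (stub A, shared with `birth`), concludes.
Colding's volume convergence theorem A.1.5(ii) — a major input of `birth`'s hardest stub — is
NOT an obligation of this line, and the remaining hard content is split along disjoint toolkits:
comparison geometry (S: Bishop–Gromov; R: Colding's local `L²` almost rigidity) versus
curvature-free metric–smooth gluing (T: Reifenberg + stability of almost-compatible gluing data).

## Stubs (4; sorries live ONLY here)

* `stub_coldingVolumeShapeFour` (A, XL) — Colding 1996 *Shape*, Main Theorem, `n = 4`: almost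
  maximal volume ⟹ `ε`-GH-approximation to the unit ROUND `S⁴` (`IsRoundSphereGHApprox`).
  Verbatim the registered stub of `birth` (= `n = 4` instance of the tree fact
  `Literature.Geometry.Riemannian.Colding1996_volume_ghClose`, bridge proved in `birth`).
* `stub_volumeSaturation` (S, L) — Bishop–Gromov relative volume comparison on the manifold
  (Chavel 2006 Thm III.4.5; Lee 2018 Thm 11.19; CC97 (0.5)/(1.2)) + Myers: `Ric_h ≥ 3h`,
  `Vol(M) ≥ (1 − δ)·8π²/3` ⟹ `Vol B̄_r(x) ≥ (1 − δ)·2π²(2/3 − cos r + cos³ r/3)` for all `x`,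
  `0 < r ≤ π` (closed `d_h`-balls, `d_h = Manifold.riemannianEDist`). The tree PROVES the absolute
  Bishop bound `Vol B̄_r(p) ≤ V₁(r)` and `Vol M ≤ |S⁴|` (`BishopVolumeComparison.lean`), Myers
  (`BonnetMyers.lean`), the per-direction Jacobian monotonicity (`ExpMapJacobianAntitone.lean`,
  `jacobi_det_div_sin_pow_antitoneOn`), Gromov's ratio lemma and Bishop–Gromov in polar data
  (`bishopGromov_polar_of_ricci_ge`, `VolumeSphereTheoremProofs.lean` §2, §9), the area formula
  for injective `C¹` maps (`RiemVolumeImageEq.lean`) and injectivity of `exp_p` before the cut time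
  (`CutLocusMultiplicity.lean`); missing: polar disintegration of `T_pM` (Mathlib
  `MeasureTheory.Measure.toSphere`) threaded through `exp_p`. No topology in the conclusion.
* `stub_reifenbergOfAlmostMaximalVolume` (R, XL) — Cheeger–Colding 1997 Thm A.1.5(i) (p. 458) =
  Colding, Ann. of Math. 145 (1997) [26], at every scale, `n = 4`, under `Ric ≥ 3`: `∀ ε ∃ δ, r₀`:
  saturation at `δ` ⟹ for every `x` and `0 < s ≤ r₀` a POINTED `εs`-Gromov–Hausdorff approximation
  `φ : M → ℝ⁴`, `φ x = 0`, of the `d_h`-ball `B_s(x)` to the Euclidean ball `B_s(0) ⊂ ℝ⁴`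
  (distortion `≤ εs` on `B_s(x)`, `εs`-dense in `B_s(0)`), i.e. `(M, d_h)` is uniformly
  `(ε, r₀)`-Reifenberg ((4.6) with `X` a point; pointed form, equivalent up to `ε ↦ 3ε`). Metric
  conclusion, no topology. Inputs in print: Bishop–Gromov, segment inequality, Colding's
  `L²`-Toponogov / Cheeger–Colding 1996 almost rigidity ("almost volume cone ⟹ almost metric cone").
* `stub_reifenbergSphereStability` (T, XL) — Cheeger–Colding 1997 Thm A.1.3 (p. 457) with
  `Z₁ = (M, d_h)`, `Z₂ =` the unit round `S⁴` (itself `(ε₀, r)`-Reifenberg for small `r`, being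
  smooth and compact): `∃ ε₀ ∀ r₀ ∃ η`: a compact connected smooth Riemannian 4-manifold that is
  uniformly `(ε₀, r₀)`-Reifenberg (pointed form as in R) and admits an `η`-GH-approximation to the
  round `S⁴` is `C^∞`-DIFFEOMORPHIC to `S⁴` ("if Z₁, Z₂ are smooth n-dimensional Riemannian
  manifolds, then … F₁, F₂ can be chosen to be diffeomorphisms. Thus Z₁ and Z₂ are diffeomorphic in
  this case", p. 457). NO curvature, NO volume, NO measure: pure metric-smooth (Reifenberg's
  iteration A.1.2, the `ε`-isometry / Gram–Schmidt / limit-map / covering layers of which are landed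
  in `VolumeSphereTheoremReifenbergProofs.lean` §R1–§R8, plus stability of almost-compatible gluing
  data, Cheeger's finiteness technique).

`VolumeSphereRecognition_of` proves the crux BY NAME from the four stubs by pure logic: `ε₀` from
T; `(δ_R, r₀)` from R at `ε₀`; `η` from T at `r₀`; `δ_A` from A at `η`; `δ := min δ_R δ_A`; a
`(M, h)` with `Ric ≥ 3h`, `Vol ≥ (1 − δ)·8π²/3` is saturated at `δ_R` (S), hence
`(ε₀, r₀)`-Reifenberg (R), and `η`-GH-close to `S⁴` (A), hence diffeomorphic to `S⁴` (T).

## Disproof.lean honoured / negatives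

None exists for this crux (`ledger crux ls stmt-SmoothPoincare4-5191`, 2026-08-17: Lines/birth.*
only); `ledger negatives --problem SmoothPoincare4`: nothing on this crux's shapes; no
`Theorems/VolumeSphereRecognition/Negative/`. No stub is an instance of a landed Negative lemma.
-/

noncomputable section

-- the prescribed namespace `Summit.<P>.<Sub>.…` duplicates `SmoothPoincare4` (P = Sub)
set_option linter.dupNamespace false

open scoped Manifold ContDiff Topology ENNReal

namespace Summit.SmoothPoincare4.SmoothPoincare4.Cruxes.VolumeSphereRecognition.SaturationReifenberg

/-! ## Stub A — Colding 1996 (Shape), Main Theorem, in dimension four (shared with `birth`) -/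

/-- **Stub A (Colding 1996, *Shape of manifolds with positive Ricci curvature*, Invent. Math. 124
(1996) 175–191, Main Theorem; `n = 4`)** — byte-identical with `Birth.stub_coldingVolumeShapeFour`
(registered on the item): for every `ε > 0` there is `δ > 0` such that a compact connected `C^∞`
Riemannian 4-manifold with `Ric ≥ 3` and `Vol ≥ (1 − δ)·8π²/3` admits an `ε`-Gromov–Hausdorff
approximation to the unit round `S⁴` (`Literature.Geometry.Riemannian.IsRoundSphereGHApprox`). The
`n = 4` instance of the tree fact `Literature.Geometry.Riemannian.Colding1996_volume_ghClose`
(bridge `Birth.coldingVolumeShapeFour_of_fact`). [cite: Colding1996Shape, Main Theorem;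
CheegerColding1997, p. 459, ref. [24]] -/
theorem stub_coldingVolumeShapeFour :
    ∀ ε : ℝ, 0 < ε → ∃ δ : ℝ, 0 < δ ∧
      ∀ (M : Type) [TopologicalSpace M] [T2Space M] [SecondCountableTopology M]
        [ChartedSpace (EuclideanSpace ℝ (Fin 4)) M] [IsManifold (𝓡 4) ∞ M] [CompactSpace M]
        [ConnectedSpace M] [MeasurableSpace M] [BorelSpace M]
        (h : Bundle.ContMDiffRiemannianMetric (𝓡 4) ∞ (EuclideanSpace ℝ (Fin 4))
          (TangentSpace (𝓡 4) : M → Type _))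
        [(Literature.Geometry.Lorentzian.PseudoRiemannianMetric.ofRiemannian h).HasLeviCivita],
        (∀ (x : M) (v : TangentSpace (𝓡 4) x), 3 * h.inner x v v ≤
            (Literature.Geometry.Lorentzian.PseudoRiemannianMetric.ofRiemannian h).ricci x v v) →
          ENNReal.ofReal ((1 - δ) * (8 * Real.pi ^ 2 / 3)) ≤
              Literature.Geometry.Lorentzian.riemannianMeasure h Set.univ →
            ∃ f : M → Metric.sphere (0 : EuclideanSpace ℝ (Fin 5)) 1,
              Literature.Geometry.Riemannian.IsRoundSphereGHApprox 4 h ε f := by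
  sorry

/-! ## Stub S — Bishop–Gromov saturation: every ball at every scale is almost maximal -/

/-- **Stub S (Bishop–Gromov relative volume comparison + Myers; Chavel 2006 Thm III.4.5, Lee 2018
Thm 11.19, Cheeger–Colding 1997 (0.5)/(1.2); `n = 4`, `κ = 1`).** On a compact connected `C^∞`
Riemannian 4-manifold `(M, h)` with `Ric_h ≥ 3h` and `Vol(M, h) ≥ (1 − δ)·8π²/3`
(`riemannianMeasure h univ`), every CLOSED `d_h`-ball satisfies
`Vol B̄_r(x) ≥ (1 − δ)·V₁(r)`, `V₁(r) = |S³| ∫₀ʳ sin³ t dt = 2π²(2/3 − cos r + cos³ r/3)` (the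
volume of the `r`-ball of the unit round `S⁴`; `V₁(π) = 8π²/3`), for all `x ∈ M` and
`0 < r ≤ π`: the ratio `Vol B̄_r(x)/V₁(r)` is non-increasing in `r ∈ (0, π]` (Bishop–Gromov) and
equals `Vol(M)/|S⁴| ≥ 1 − δ` at `r = π` (`B̄_π(x) = M`, Myers). Here
`d_h = Manifold.riemannianEDist` (Mathlib's length distance of `h`, the distance of
`IsRoundSphereGHApprox` and of `riemannianMeasure`). No topology in the conclusion.
[cite: Chavel2006, Thm. III.4.5; LeeRiemannianManifolds2018, Thm. 11.19; CheegerColding1997, (0.5), (1.2)] -/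
theorem stub_volumeSaturation :
    ∀ δ : ℝ, 0 < δ →
      ∀ (M : Type) [TopologicalSpace M] [T2Space M] [SecondCountableTopology M]
        [ChartedSpace (EuclideanSpace ℝ (Fin 4)) M] [IsManifold (𝓡 4) ∞ M] [CompactSpace M]
        [ConnectedSpace M] [MeasurableSpace M] [BorelSpace M]
        (h : Bundle.ContMDiffRiemannianMetric (𝓡 4) ∞ (EuclideanSpace ℝ (Fin 4))
          (TangentSpace (𝓡 4) : M → Type _))
        [(Literature.Geometry.Lorentzian.PseudoRiemannianMetric.ofRiemannian h).HasLeviCivita],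
        (∀ (x : M) (v : TangentSpace (𝓡 4) x), 3 * h.inner x v v ≤
            (Literature.Geometry.Lorentzian.PseudoRiemannianMetric.ofRiemannian h).ricci x v v) →
          ENNReal.ofReal ((1 - δ) * (8 * Real.pi ^ 2 / 3)) ≤
              Literature.Geometry.Lorentzian.riemannianMeasure h Set.univ →
            (open Bundle in
            letI : Bundle.RiemannianBundle (fun x : M ↦ TangentSpace (𝓡 4) x) :=
              ⟨h.toContinuousRiemannianMetric.toRiemannianMetric⟩;
            ∀ (x : M) (r : ℝ), 0 < r → r ≤ Real.pi →
              ENNReal.ofReal ((1 - δ) *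
                  (2 * Real.pi ^ 2 * (2 / 3 - Real.cos r + Real.cos r ^ 3 / 3))) ≤
                Literature.Geometry.Lorentzian.riemannianMeasure h
                  {y : M | Manifold.riemannianEDist (𝓡 4) x y ≤ ENNReal.ofReal r}) := by
  sorry

/-! ## Stub R — Colding 1997 / Cheeger–Colding A.1.5(i): almost maximal volume at every scale ⟹
uniformly Reifenberg flat -/

/-- **Stub R (Cheeger–Colding 1997, Appendix 1, Thm A.1.5(i), p. 458, "[26]" = Colding, *Ricci
curvature and volume convergence*, Ann. of Math. 145 (1997); applied at every scale; `n = 4`,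
under `Ric ≥ 3`).** Printed: "For all `ε > 0` there exists `r = r(n, ε)`, `δ = δ(n, ε) > 0` …
Let `Ric_{Mⁿ} ≥ −(n − 1)`, `p ∈ Mⁿ` and `r₁ ≤ r`. i) If `Vol(B_{r₁}(p)) ≥ (1 − δ) Vol(B_{r₁}(0))`
then `p ∈ (ℛ_n)_{ε, r₁}`", where (p. 431, (4.6)) `(ℛ_n)_{ε,r}` is the set of points `y` with
`d_GH(B_s(y), B_s(0)) < εs` for all `s ∈ (0, u]`, some `u > r`, `0 ∈ ℝⁿ`. Tree form: for every
`ε > 0` there are `δ > 0` and `r₀ > 0` such that on a compact connected `C^∞` Riemannian 4-manifold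
`(M, h)` with `Ric_h ≥ 3h` (`≥ −3h`) whose closed balls are saturated,
`Vol B̄_r(x) ≥ (1 − δ)·2π²(2/3 − cos r + cos³ r/3)` for all `x`, `0 < r ≤ π` (the conclusion of
stub S; `2π²(2/3 − cos r + cos³ r/3) = (π²/2) r⁴ (1 − O(r²))` is almost the Euclidean `ω₄ r⁴` for
`r ≤ r₀`), every ball `B_s(x)`, `0 < s ≤ r₀`, admits a POINTED `εs`-Gromov–Hausdorff approximation
to the Euclidean ball `B_s(0) ⊂ ℝ⁴`: a map `φ : M → ℝ⁴` with `φ x = 0`, distortion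
`|‖φ a − φ b‖ − d_h(a, b)| ≤ εs` for `a, b ∈ B_s(x)`, and image `εs`-dense in `B_s(0)` — i.e.
`(M, d_h)` is uniformly `(ε, r₀)`-Reifenberg flat in the sense consumed by stub T (the pointed form
follows from (4.6) at the cost `ε ↦ 3ε`, the centre of an `εs`-self-approximation of a Euclidean
ball moving by `≤ 2εs`). Metric conclusion, no topology; `d_h = Manifold.riemannianEDist`.
[cite: CheegerColding1997, Appendix 1 Thm A.1.5 (i) (p. 458) and (4.6) (p. 431); Colding1997, [26]] -/
theorem stub_reifenbergOfAlmostMaximalVolume :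
    ∀ ε : ℝ, 0 < ε → ∃ δ : ℝ, 0 < δ ∧ ∃ r₀ : ℝ, 0 < r₀ ∧
      ∀ (M : Type) [TopologicalSpace M] [T2Space M] [SecondCountableTopology M]
        [ChartedSpace (EuclideanSpace ℝ (Fin 4)) M] [IsManifold (𝓡 4) ∞ M] [CompactSpace M]
        [ConnectedSpace M] [MeasurableSpace M] [BorelSpace M]
        (h : Bundle.ContMDiffRiemannianMetric (𝓡 4) ∞ (EuclideanSpace ℝ (Fin 4))
          (TangentSpace (𝓡 4) : M → Type _))
        [(Literature.Geometry.Lorentzian.PseudoRiemannianMetric.ofRiemannian h).HasLeviCivita],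
        (∀ (x : M) (v : TangentSpace (𝓡 4) x), 3 * h.inner x v v ≤
            (Literature.Geometry.Lorentzian.PseudoRiemannianMetric.ofRiemannian h).ricci x v v) →
          (open Bundle in
          letI : Bundle.RiemannianBundle (fun x : M ↦ TangentSpace (𝓡 4) x) :=
            ⟨h.toContinuousRiemannianMetric.toRiemannianMetric⟩;
          (∀ (x : M) (r : ℝ), 0 < r → r ≤ Real.pi →
              ENNReal.ofReal ((1 - δ) *
                  (2 * Real.pi ^ 2 * (2 / 3 - Real.cos r + Real.cos r ^ 3 / 3))) ≤
                Literature.Geometry.Lorentzian.riemannianMeasure h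
                  {y : M | Manifold.riemannianEDist (𝓡 4) x y ≤ ENNReal.ofReal r}) →
            ∀ (x : M) (s : ℝ), 0 < s → s ≤ r₀ →
              ∃ φ : M → EuclideanSpace ℝ (Fin 4), φ x = 0 ∧
                (∀ a b : M, (Manifold.riemannianEDist (𝓡 4) x a).toReal < s →
                  (Manifold.riemannianEDist (𝓡 4) x b).toReal < s →
                    |dist (φ a) (φ b) - (Manifold.riemannianEDist (𝓡 4) a b).toReal| ≤ ε * s) ∧
                (∀ v : EuclideanSpace ℝ (Fin 4), ‖v‖ < s →
                  ∃ a : M, (Manifold.riemannianEDist (𝓡 4) x a).toReal < s ∧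
                    dist (φ a) v ≤ ε * s)) := by
  sorry

/-! ## Stub T — Cheeger–Colding A.1.3 against the round `S⁴`: Reifenberg flat + GH-close ⟹
diffeomorphic (curvature-free) -/

/-- **Stub T (Cheeger–Colding 1997, Appendix 1, Thm A.1.3, p. 457, with `Z₁ = (M, d_h)` and
`Z₂ =` the unit round `S⁴`).** Printed: "The number `ε(n) > 0` can be chosen such that if
`d_GH(Z₁, Z₂) < ε(n)` [`Z₁, Z₂ ∈ 𝓜(n, ε, r)`: every point `(ε, r)`-Reifenberg], then we can choose
`(W₁ⁿ, g₁) = (W₂ⁿ, g₂)`. Moreover, if `Z₁, Z₂` are smooth `n`-dimensional Riemannian manifolds, then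
for this `W₁ⁿ = W₂ⁿ`, the maps `F₁, F₂` can be chosen to be diffeomorphisms. Thus, `Z₁` and `Z₂`
are diffeomorphic in this case." Tree form (`n = 4`; the round `S⁴` is `(ε₀, r)`-Reifenberg for
`r ≤ r(ε₀)`, being smooth and compact; the GH threshold scales with `min(r₀, r(ε₀))`, whence the
order of quantifiers): there is `ε₀ > 0` such that for every `r₀ > 0` there is `η > 0` such that
every compact connected `C^∞` Riemannian 4-manifold `(M, h)` which is uniformly
`(ε₀, r₀)`-Reifenberg flat in the pointed sense (every `d_h`-ball `B_s(x)`, `0 < s ≤ r₀`, admits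
`φ : M → ℝ⁴`, `φ x = 0`, with distortion `≤ ε₀ s` on `B_s(x)` and image `ε₀ s`-dense in `B_s(0)`;
this implies (4.6) verbatim) and which admits an `η`-Gromov–Hausdorff approximation to the unit
round `S⁴` (`IsRoundSphereGHApprox 4 h η f`, so `d_GH((M, d_h), (S⁴, ∠)) ≤ 3η/2`,
`IsRoundSphereGHApprox.ghDist_le`) is `C^∞`-diffeomorphic to `S⁴ ⊂ ℝ⁵`. NO curvature, NO volume,
NO measure hypothesis: the intrinsic Reifenberg theorem A.1.2 (pp. 459–468) and the stability of
its gluing data (A.1.3). [cite: CheegerColding1997, Appendix 1 Thms A.1.2–A.1.3 (p. 457), proof pp. 459–468] -/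
theorem stub_reifenbergSphereStability :
    ∃ ε₀ : ℝ, 0 < ε₀ ∧ ∀ r₀ : ℝ, 0 < r₀ → ∃ η : ℝ, 0 < η ∧
      ∀ (M : Type) [TopologicalSpace M] [T2Space M] [SecondCountableTopology M]
        [ChartedSpace (EuclideanSpace ℝ (Fin 4)) M] [IsManifold (𝓡 4) ∞ M] [CompactSpace M]
        [ConnectedSpace M]
        (h : Bundle.ContMDiffRiemannianMetric (𝓡 4) ∞ (EuclideanSpace ℝ (Fin 4))
          (TangentSpace (𝓡 4) : M → Type _)),
        (open Bundle in
        letI : Bundle.RiemannianBundle (fun x : M ↦ TangentSpace (𝓡 4) x) :=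
          ⟨h.toContinuousRiemannianMetric.toRiemannianMetric⟩;
        (∀ (x : M) (s : ℝ), 0 < s → s ≤ r₀ →
            ∃ φ : M → EuclideanSpace ℝ (Fin 4), φ x = 0 ∧
              (∀ a b : M, (Manifold.riemannianEDist (𝓡 4) x a).toReal < s →
                (Manifold.riemannianEDist (𝓡 4) x b).toReal < s →
                  |dist (φ a) (φ b) - (Manifold.riemannianEDist (𝓡 4) a b).toReal| ≤ ε₀ * s) ∧
              (∀ v : EuclideanSpace ℝ (Fin 4), ‖v‖ < s →
                ∃ a : M, (Manifold.riemannianEDist (𝓡 4) x a).toReal < s ∧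
                  dist (φ a) v ≤ ε₀ * s)) →
          (∃ f : M → Metric.sphere (0 : EuclideanSpace ℝ (Fin 5)) 1,
              Literature.Geometry.Riemannian.IsRoundSphereGHApprox 4 h η f) →
            Nonempty (M ≃ₘ⟮𝓡 4, 𝓡 4⟯ Metric.sphere (0 : EuclideanSpace ℝ (Fin 5)) 1)) := by
  sorry

/-! ## The composition (kernel-checked; no `sorry` of its own) -/

/-- **Line `saturation_reifenberg` concludes the crux BY NAME.** Take `ε₀` from the Reifenberg
sphere stability T; `δ_R, r₀` from Colding's local almost rigidity R at `ε₀`; `η` from T at `r₀`;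
`δ_A` from Colding's Shape theorem A at `η`; put `δ = min δ_R δ_A`. A compact connected `(M⁴, h)`
with `Ric_h ≥ 3h` and `Vol ≥ (1 − δ)·8π²/3` has `Vol ≥ (1 − δ_R)·8π²/3` and `≥ (1 − δ_A)·8π²/3`;
by Bishop–Gromov saturation S every closed ball is `δ_R`-almost maximal, so by R `(M, d_h)` is
uniformly `(ε₀, r₀)`-Reifenberg; by A it is `η`-GH-close to the round `S⁴`; by T it is
diffeomorphic to `S⁴`. [cite: CheegerColding1997, Appendix 1, Thms A.1.3, A.1.5 (i), A.1.10 and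
the sentence "By combining Theorems A.1.1 and A.1.5" (p. 458)] -/
theorem VolumeSphereRecognition_of :
    Summit.SmoothPoincare4.SmoothPoincare4.Theses.RicciFat.VolumeSphereRecognition := by
  obtain ⟨ε₀, hε₀, HT⟩ := stub_reifenbergSphereStability
  obtain ⟨δR, hδR, r₀, hr₀, HR⟩ := stub_reifenbergOfAlmostMaximalVolume ε₀ hε₀
  obtain ⟨η, hη, HT'⟩ := HT r₀ hr₀
  obtain ⟨δA, hδA, HA⟩ := stub_coldingVolumeShapeFour η hη
  refine ⟨min δR δA, lt_min hδR hδA, ?_⟩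
  intro M _ _ _ _ _ _ _ _ _ h _ hRic hVol
  have hc : (0 : ℝ) ≤ 8 * Real.pi ^ 2 / 3 := by positivity
  have hVolR : ENNReal.ofReal ((1 - δR) * (8 * Real.pi ^ 2 / 3)) ≤
      Literature.Geometry.Lorentzian.riemannianMeasure h Set.univ := by
    refine le_trans (ENNReal.ofReal_le_ofReal ?_) hVol
    exact mul_le_mul_of_nonneg_right (by linarith [min_le_left δR δA]) hc
  have hVolA : ENNReal.ofReal ((1 - δA) * (8 * Real.pi ^ 2 / 3)) ≤
      Literature.Geometry.Lorentzian.riemannianMeasure h Set.univ := by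
    refine le_trans (ENNReal.ofReal_le_ofReal ?_) hVol
    exact mul_le_mul_of_nonneg_right (by linarith [min_le_right δR δA]) hc
  have hSat := stub_volumeSaturation δR hδR M h hRic hVolR
  have hReif := HR M h hRic hSat
  exact HT' M h hReif (HA M h hRic hVolA)

end Summit.SmoothPoincare4.SmoothPoincare4.Cruxes.VolumeSphereRecognition.SaturationReifenberg

end
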